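import Literature.NumberTheory.EllipticCurves.LocalEulerCharacteristicTorsion
import Literature.NumberTheory.GaloisRepresentations.LocalEulerCharCoprime
import HarnessLib

/-!
# `#H¹(K_v, E[n]) = #E(K_v)[n]²` at a place `v ∤ n`, unconditionally; vanishing of the local
# conditions when `E(K_v)[n] = 0`

Topic `NumberTheory/EllipticCurves`; namespace `Literature.NumberTheory.EllipticCurves` (the curve-facing
corollaries are dot-notation extensions in Mathlib's `WeierstrassCurve` namespace, like
`selmerLocalKer_eq_top_of_isAlgClosed`). Theorems only: **no definition, no named fact** (D-0026).

Let `K` be a number field, `E = W` an elliptic curve over `K`, `v` a finite place with completion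
`K_v = v.adicCompletion K`, and `n ≥ 1` an integer with `(n) ⊄ v`, i.e. `n` prime to the residue
characteristic of `v`.  The tree's `natCard_galoisCohomology_one_torsion_adicCompletion_eq_sq`
(`LocalEulerCharacteristicTorsion.lean`) computes `#H¹(K_v, E[n]) = (#E(K_v)[n] · #(𝓞_v/n))²` for prime
powers `n` FROM the named fact `localEulerPoincareCharacteristic K_v` (Milne, *ADT*, I Thm. 2.8).  At a
place `v ∤ n` that fact is not needed: the prime-to-`p` case of Tate's local Euler–Poincaré
characteristic is PROVED in the tree at every level (`LocalEulerCharCoprime.lean`,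
`natCard_one_eq_natCard_invariants_mul`: `#H¹(F, M) = #M^{Γ_F} · #Hom_{Γ_F}(M, μₙ)` for `char 𝓀(F) ∤ n`),
and the Weil pairing identifies `Hom_{Γ_F}(E[n], μₙ)` with `E[n]^{Γ_F}` (`weilDualLocalIso`,
`exists_weilPairing_holds`).  Hence, with NO hypothesis beyond `v ∤ n`:

* `natCard_galoisCohomology_one_torsion_restrictField_of_not_dvd` — **`#H¹(F, E[n]) = #E(F)[n]²`** for
  every `K`-field `F` which is a non-archimedean local field of characteristic `0` with `char 𝓀(F) ∤ n`;
* `natCard_galoisCohomology_one_torsion_adicCompletion_eq_sq_of_not_mem` — the same at `F = K_v`,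
  `(n) ⊄ v` (Milne I Thm. 2.8 + Cor. 2.3 for `M = E[n]`, `(𝓞_v : n𝓞_v) = 1`);
* `natCard_torsionBy_galoisCohomology_localGaloisModule_eq_of_not_mem` — the order form of Tate local
  duality for `E` at `v ∤ n`: **`#H¹(K_v, E)[n] = #E(K_v)[n] = #(E(K_v)/nE(K_v))`** (Milne I Thm. 3.2 /
  Lemma 3.3; the tree's `…_of_eulerChar` fed with the unconditional count);
* **VANISHING**: if `E(K_v)` has no `n`-torsion (`∀ P, n • P = 0 → P = 0`) then `H¹(K_v, E[n]) = 0`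
  (`subsingleton_galoisCohomology_one_torsion_adicCompletion_of_forall_nsmul_eq_zero`), so EVERY class
  of `H¹(K, E[n])` restricts to zero at `v`: it satisfies the Selmer local condition
  (`WeierstrassCurve.selmerLocalKer_adicCompletion_eq_top_of_forall_nsmul_eq_zero`,
  `…mem_selmerLocalKer_adicCompletion_of_forall_nsmul_eq_zero`) and the strict local condition
  (`WeierstrassCurve.torsionLocalKer_adicCompletion_eq_top_of_forall_nsmul_eq_zero`), and at all levels
  `ℓ^k` at once from `E(K_v)[ℓ] = 0`
  (`WeierstrassCurve.mem_selmerLocalKer_and_mem_torsionLocalKer_adicCompletion_pow`).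

This is the mechanism «at `v ∣ 3` and `v ∣ p` NOTHING to check because `H¹(K_w, X[2^M]) = 0` … by local
duality / Euler characteristic» of the Kolyvagin argument at `p = 2` for the Hu–Shu–Yin pair over `ℚ(ω)`
(cell memo MEMO-bsd-cm-two §57.1 (F3), §57.3 «LOCAL BEHAVIOUR OFF n»; crux `UpperOffV0HSYPlus`,
stmt-BirchSwinnertonDyer-19804, leaf (L1) of `Theorems/SylvesterTwoHeegnerIndexCoupledDescentAtTwo`),
recorded generically: at an additive place `v ∤ n` where `E[n](K_v) = 0` both local conditions of a
Kolyvagin-type descent are empty.  Nothing here is specific to that crux; BSD is not claimed.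

## References

* [MilneADT2006] J. S. Milne, *Arithmetic Duality Theorems*, 2nd ed. (2006), Ch. I: Cor. 2.3, Thm. 2.8,
  Lemma 2.9, Thm. 3.2, Lemma 3.3.
* [SerreGaloisCohomology1997] J.-P. Serre, *Galois Cohomology* (1997), II §5.2 Thm. 2, §5.7 Thm. 5.
* [SilvermanAEC2009] J. H. Silverman, *The Arithmetic of Elliptic Curves*, 2nd ed. (2009), III.8.1, X.§4.
* [GrossLMS1991] B. H. Gross, *Kolyvagin's work on modular elliptic curves*, LMS LNS 153 (1991), §6.
-/

noncomputable section

open scoped Classical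

open CategoryTheory Function
open Field IsNonarchimedeanLocalField ValuativeRel

universe u

namespace Literature.NumberTheory.EllipticCurves

open _root_.WeierstrassCurve Field Function NumberField IsDedekindDomain
open Literature.NumberTheory.GaloisRepresentations
open Literature.NumberTheory.GaloisRepresentations.DiscreteGaloisModule (mu MuCarrier)
open scoped ContRepresentation

-- No `attribute [local instance]`: the compactness of `Γ_F` and the finiteness of `E[n]`, `μₙ` needed
-- by the tree's counting theorems are introduced by `haveI` inside the two proofs that use them.

/-! ## A one-step ladder: no `ℓ`-torsion ⇒ no `ℓ^k`-torsion -/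

section Ladder

variable {A : Type*} [AddCommGroup A]

/-- If an abelian group has no `ℓ`-torsion it has no `ℓ^k`-torsion. [folklore] -/
private theorem forall_pow_nsmul_eq_zero_imp_of_forall_nsmul_eq_zero {ℓ : ℕ}
    (h : ∀ a : A, ℓ • a = 0 → a = 0) (k : ℕ) : ∀ a : A, ℓ ^ k • a = 0 → a = 0 := by
  induction k with
  | zero => intro a ha; simpa using ha
  | succ k ih =>
    intro a ha
    rw [pow_succ, mul_nsmul'] at ha
    exact h a (ih (ℓ • a) ha)

end Ladder

/-! ## `#H¹(F, E[n]) = #E(F)[n]²` for `char 𝓀(F) ∤ n` -/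

section Generic

variable {K : Type u} [Field K] [NumberField K] (W : WeierstrassCurve K) [W.IsElliptic]

/-- **`#H¹(F, E[n]) = #E(F)[n]²`, unconditionally, for `char 𝓀(F) ∤ n`.**  For an elliptic curve `E = W`
over a number field `K`, a `K`-field `F` which is a non-archimedean local field of characteristic `0`,
and `n ≥ 1` prime to the residue characteristic of `F`:
`#H¹(F, E[n]) = #E[n]^{Γ_F} · #Hom_{Γ_F}(E[n], μₙ)` (the tree's PROVED prime-to-`p` Euler characteristic
and `(2,0)`-duality count, `natCard_one_eq_natCard_invariants_mul`) `= #E(F)[n] · #E(F)[n]` (invariants =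
`E(F)[n]`, `natCard_invariants_torsion_restrictField`; `Hom_{Γ_F}(E[n], μₙ) ≅ E[n]^{Γ_F}` by the Weil
pairing, `weilDualLocalIso`).  [cite: MilneADT2006, Ch. I, Cor. 2.3, Thm. 2.8 and Lemma 2.9]
[cite: SilvermanAEC2009, Prop. III.8.1] -/
theorem natCard_galoisCohomology_one_torsion_restrictField_of_not_dvd (F : Type u) [Field F]
    [Algebra K F] [CharZero F] [ValuativeRel F] [TopologicalSpace F] [IsNonarchimedeanLocalField F]
    (n : ℕ) [NeZero n] (hn : ¬ ringChar 𝓀[F] ∣ n) :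
    Nat.card (galoisCohomology (GaloisRep.restrictField F (W.torsionGaloisModule n)) 1) =
      Nat.card (nsmulAddMonoidHom n : (W.baseChange F).toAffine.Point →+ _).ker ^ 2 := by
  haveI := absoluteGaloisGroup_compactSpace F
  haveI : Finite (geomTorsion W n) := finite_geomTorsion_of_neZero W n
  haveI : Finite (MuCarrier F n) := finite_muCarrier n F
  set ρ : ContinuousRep (absoluteGaloisGroup F) ℤ (geomTorsion W n) :=
    GaloisRep.restrictField F (W.torsionGaloisModule n) with hρ
  have hM : ∀ m : geomTorsion W n, n • m = 0 := fun T ↦ AddSubgroup.torsionBy.nsmul T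
  have h1 := natCard_one_eq_natCard_invariants_mul F n hn ρ hM
  have h0 : Nat.card ρ.toTopRep.ρ.invariants =
      Nat.card (nsmulAddMonoidHom n : (W.baseChange F).toAffine.Point →+ _).ker :=
    natCard_invariants_torsion_restrictField W F (NeZero.ne n)
  change Nat.card (continuousCohomology 1 ρ.toTopRep) = _
  rcases Nat.lt_or_ge n 2 with hlt | h2
  · -- `n = 1`: `E[1] = 0`, everything is trivial
    have hn1 : n = 1 := by have := NeZero.ne n; omega
    haveI : Subsingleton (geomTorsion W n) := ⟨fun x y ↦ by
      rw [← one_nsmul x, ← one_nsmul y, ← hn1, hM, hM]⟩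
    haveI : Subsingleton ρ.toTopRep := ‹Subsingleton (geomTorsion W n)›
    haveI := subsingleton_continuousCohomology_of_subsingleton ρ.toTopRep 0
    haveI : Subsingleton ρ.toTopRep.ρ.invariants := inferInstance
    rw [Nat.card_of_subsingleton (0 : continuousCohomology 1 ρ.toTopRep), ← h0,
      Nat.card_of_subsingleton (0 : ρ.toTopRep.ρ.invariants), one_pow]
  · haveI : PerfectField K := PerfectField.ofCharZero
    obtain ⟨e, hμ, hadd₁, hadd₂, -, hnondeg, hgal⟩ :=
      exists_weilPairing_holds W n h2 (by exact_mod_cast NeZero.ne n)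
    have hD : Nat.card (ρ.homRep (mu F n)).toTopRep.ρ.invariants = Nat.card ρ.toTopRep.ρ.invariants :=
      (Nat.card_congr (invariantsEquivOfIso (τ₁ := ρ) (τ₂ := ρ.homRep (mu F n))
        (weilDualLocalIso W n e hμ hadd₁ hadd₂ F hgal hnondeg))).symm
    rw [h1, hD, h0, sq]

end Generic

/-! ## At the completion `K_v`, `(n) ⊄ v` -/

section Place

variable {K : Type u} [Field K] [NumberField K] (W : WeierstrassCurve K) [W.IsElliptic]
variable (v : HeightOneSpectrum (𝓞 K))

omit [W.IsElliptic] in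
/-- The residue characteristic of `K_v` does not divide `n` when `(n) ⊄ v`: otherwise
`q = char 𝓀(K_v) ∣ n`, and `q` has residue `0`, so `q ∈ 𝓂[K_v]`, i.e. `v(q) < 1`, i.e. `(q) ⊆ v`, and
then `(n) ⊆ v`.  (A private copy of the tree's `not_ringChar_residueField_adicCompletion_dvd`, file
`LocalH1TateDualityLangTateProofs`, whose imports are not wanted here.) [folklore] -/
private theorem not_ringChar_residueField_dvd_of_natCast_not_mem {n : ℕ}
    (hv : ((n : ℕ) : 𝓞 K) ∉ v.asIdeal) : ¬ ringChar 𝓀[v.adicCompletion K] ∣ n := by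
  rintro ⟨m, hm⟩
  set q := ringChar 𝓀[v.adicCompletion K] with hq
  -- `(q) ⊆ v`
  have hqv : ((q : ℕ) : 𝓞 K) ∈ v.asIdeal := by
    by_contra hqv
    have h0 : ((q : ℕ) : 𝓀[v.adicCompletion K]) = 0 := (ringChar.spec 𝓀[v.adicCompletion K] q).2 dvd_rfl
    have h1 : ¬ IsUnit ((q : ℕ) : 𝒪[v.adicCompletion K]) := fun hu ↦ by
      have h' := hu.map (IsLocalRing.residue 𝒪[v.adicCompletion K])
      rw [map_natCast] at h'
      exact h'.ne_zero h0
    rw [Valuation.Integer.not_isUnit_iff_valuation_lt_one] at h1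
    have h2 : Valued.v (((q : ℕ) : 𝒪[v.adicCompletion K]) : v.adicCompletion K) < 1 :=
      (Valuation.vlt_one_iff
        (Valued.v : Valuation (v.adicCompletion K) (WithZero (Multiplicative ℤ)))).mp
        ((Valuation.vlt_one_iff (ValuativeRel.valuation (v.adicCompletion K))).mpr h1)
    have h3 : (((q : ℕ) : 𝒪[v.adicCompletion K]) : v.adicCompletion K) =
        ((algebraMap (𝓞 K) K q : K) : v.adicCompletion K) := by
      rw [SubringClass.coe_natCast, map_natCast]
      exact (map_natCast (algebraMap K (v.adicCompletion K)) q).symm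
    rw [h3, HeightOneSpectrum.valuedAdicCompletion_eq_valuation',
      HeightOneSpectrum.valuation_lt_one_iff_mem] at h2
    exact hqv h2
  apply hv
  have : ((n : ℕ) : 𝓞 K) = ((q : ℕ) : 𝓞 K) * ((m : ℕ) : 𝓞 K) := by rw [hm]; push_cast; ring
  rw [this]
  exact v.asIdeal.mul_mem_right _ hqv

/-- **`#H¹(K_v, E[n]) = #E(K_v)[n]²` at a finite place `v` with `(n) ⊄ v`, unconditionally** (Milne I
Thm. 2.8 + Cor. 2.3 for `M = E[n]` at a place prime to `n`: `(𝓞_v : n𝓞_v) = 1`).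
[cite: MilneADT2006, Ch. I, Cor. 2.3 and Thm. 2.8] [cite: SilvermanAEC2009, Prop. III.8.1] -/
theorem natCard_galoisCohomology_one_torsion_adicCompletion_eq_sq_of_not_mem (n : ℕ) [NeZero n]
    (hv : ((n : ℕ) : 𝓞 K) ∉ v.asIdeal) :
    Nat.card (galoisCohomology
        (GaloisRep.restrictField (v.adicCompletion K) (W.torsionGaloisModule n)) 1) =
      Nat.card (nsmulAddMonoidHom n :
          (W.baseChange (v.adicCompletion K)).toAffine.Point →+ _).ker ^ 2 := by
  haveI : CharZero (v.adicCompletion K) := charZero_adicCompletion v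
  exact natCard_galoisCohomology_one_torsion_restrictField_of_not_dvd W (v.adicCompletion K) n
    (not_ringChar_residueField_dvd_of_natCast_not_mem v hv)

/-- `#(𝓞_v ⧸ n) = 1` when `(n) ⊄ v`: `n` is a unit of `𝓞_v`. [folklore] -/
private theorem natCard_adicCompletionIntegers_quotient_eq_one_of_not_mem {n : ℕ}
    (hv : ((n : ℕ) : 𝓞 K) ∉ v.asIdeal) :
    Nat.card (v.adicCompletionIntegers K ⧸ Ideal.span {(n : v.adicCompletionIntegers K)}) = 1 := by
  have hunit : IsUnit ((n : ℕ) : v.adicCompletionIntegers K) := by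
    rw [HeightOneSpectrum.adicCompletionIntegers.isUnit_iff_valued_eq_one]
    have h1 : (((n : ℕ) : v.adicCompletionIntegers K) : v.adicCompletion K) =
        ((algebraMap (𝓞 K) K n : K) : v.adicCompletion K) := by
      rw [SubringClass.coe_natCast, map_natCast]
      exact (map_natCast (algebraMap K (v.adicCompletion K)) n).symm
    change Valued.v (((n : ℕ) : v.adicCompletionIntegers K) : v.adicCompletion K) = 1
    rw [h1, HeightOneSpectrum.valuedAdicCompletion_eq_valuation',
      HeightOneSpectrum.valuation_eq_one_iff_notMem]
    exact hv
  rw [Ideal.span_singleton_eq_top.mpr hunit]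
  haveI : Subsingleton (v.adicCompletionIntegers K ⧸ (⊤ : Ideal (v.adicCompletionIntegers K))) :=
    Ideal.Quotient.subsingleton_iff.mpr rfl
  exact Nat.card_of_subsingleton 0

/-- **Tate local duality for `E`, order form, at a place `v ∤ n`, unconditionally:
`#H¹(K_v, E)[n] = #E(K_v)[n]`** (Milne, *ADT*, I Thm. 3.2 with Lemma 3.3: `H¹(K, A)_n ≅ (A(K)/n)^*`, of
order `#A(K)_n · (R : nR)`, and `(𝓞_v : n𝓞_v) = 1` at `v ∤ n`) — the tree's
`natCard_torsionBy_galoisCohomology_localGaloisModule_eq_of_eulerChar` fed with the unconditional count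
`natCard_galoisCohomology_one_torsion_adicCompletion_eq_sq_of_not_mem`.
[cite: MilneADT2006, Ch. I, Thm. 3.2 and Lemma 3.3] -/
theorem natCard_torsionBy_galoisCohomology_localGaloisModule_eq_of_not_mem (n : ℕ) [NeZero n]
    (hv : ((n : ℕ) : 𝓞 K) ∉ v.asIdeal) :
    Nat.card (AddSubgroup.torsionBy
          (galoisCohomology (W.localGaloisModule (v.adicCompletion K)) 1) (n : ℤ)) =
      Nat.card (nsmulAddMonoidHom n :
            (W.baseChange (v.adicCompletion K)).toAffine.Point →+ _).ker := by
  have hq := natCard_adicCompletionIntegers_quotient_eq_one_of_not_mem v hv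
  have h := natCard_torsionBy_galoisCohomology_localGaloisModule_eq_of_eulerChar W v (NeZero.ne n)
    (by rw [hq, mul_one]; exact natCard_galoisCohomology_one_torsion_adicCompletion_eq_sq_of_not_mem W v n hv)
  rwa [hq, mul_one] at h

/-- **`#H¹(K_v, E)[n] = #(E(K_v)/nE(K_v))` at `v ∤ n`, unconditionally** (Milne I Thm. 3.2 / Cor. 3.4:
`H¹(K_v, E)[n] ≅ (E(K_v)/n)^*`, numerically). [cite: MilneADT2006, Ch. I, Thm. 3.2 and Cor. 3.4] -/
theorem natCard_torsionBy_galoisCohomology_localGaloisModule_eq_card_quotient_of_not_mem (n : ℕ)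
    [NeZero n] (hv : ((n : ℕ) : 𝓞 K) ∉ v.asIdeal) :
    Nat.card (AddSubgroup.torsionBy
          (galoisCohomology (W.localGaloisModule (v.adicCompletion K)) 1) (n : ℤ)) =
      Nat.card ((W.baseChange (v.adicCompletion K)).toAffine.Point ⧸
        (nsmulAddMonoidHom n : (W.baseChange (v.adicCompletion K)).toAffine.Point →+ _).range) := by
  have hq := natCard_adicCompletionIntegers_quotient_eq_one_of_not_mem v hv
  exact natCard_torsionBy_galoisCohomology_localGaloisModule_eq_card_quotient_of_eulerChar W v
    (NeZero.ne n) (by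
      rw [hq, mul_one]
      exact natCard_galoisCohomology_one_torsion_adicCompletion_eq_sq_of_not_mem W v n hv)

end Place

/-! ## Vanishing: `E(K_v)[n] = 0` at `v ∤ n` ⇒ `H¹(K_v, E[n]) = 0` ⇒ both local conditions are empty -/

section Vanishing

variable {K : Type u} [Field K] [NumberField K] (W : WeierstrassCurve K) [W.IsElliptic]
variable (v : HeightOneSpectrum (𝓞 K))

omit [NumberField K] [W.IsElliptic] in
/-- No `n`-torsion in `E(F)` means the kernel of `n •` on `E(F)` is trivial (as a count). [folklore] -/
private theorem natCard_ker_nsmulAddMonoidHom_eq_one_of_forall (F : Type u) [Field F] [Algebra K F]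
    (n : ℕ)
    (htors : ∀ P : (W.baseChange F).toAffine.Point, n • P = 0 → P = 0) :
    Nat.card (nsmulAddMonoidHom n : (W.baseChange F).toAffine.Point →+ _).ker = 1 := by
  have hbot : (nsmulAddMonoidHom n : (W.baseChange F).toAffine.Point →+ _).ker = ⊥ := by
    rw [eq_bot_iff]
    intro P hP
    exact (AddSubgroup.mem_bot).mpr (htors P (by simpa using hP))
  rw [hbot]
  exact AddSubgroup.card_bot

/-- **`H¹(F, E[n]) = 0` when `E(F)[n] = 0` and `char 𝓀(F) ∤ n`** (for a `K`-field `F` which is a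
non-archimedean local field of characteristic `0`): `#H¹(F, E[n]) = #E(F)[n]² = 1`.
[cite: MilneADT2006, Ch. I, Cor. 2.3 and Thm. 2.8] -/
theorem subsingleton_galoisCohomology_one_torsion_restrictField_of_forall_nsmul_eq_zero (F : Type u)
    [Field F] [Algebra K F] [CharZero F] [ValuativeRel F] [TopologicalSpace F]
    [IsNonarchimedeanLocalField F] (n : ℕ) [NeZero n] (hn : ¬ ringChar 𝓀[F] ∣ n)
    (htors : ∀ P : (W.baseChange F).toAffine.Point, n • P = 0 → P = 0) :
    Subsingleton (galoisCohomology (GaloisRep.restrictField F (W.torsionGaloisModule n)) 1) := by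
  have hcard := natCard_galoisCohomology_one_torsion_restrictField_of_not_dvd W F n hn
  rw [natCard_ker_nsmulAddMonoidHom_eq_one_of_forall W F n htors, one_pow] at hcard
  exact (Nat.card_eq_one_iff_unique.mp hcard).1

/-- **`H¹(K_v, E[n]) = 0` when `E(K_v)[n] = 0` and `(n) ⊄ v`.** [cite: MilneADT2006, Ch. I, Cor. 2.3 and Thm. 2.8] -/
theorem subsingleton_galoisCohomology_one_torsion_adicCompletion_of_forall_nsmul_eq_zero (n : ℕ)
    [NeZero n] (hv : ((n : ℕ) : 𝓞 K) ∉ v.asIdeal)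
    (htors : ∀ P : (W.baseChange (v.adicCompletion K)).toAffine.Point, n • P = 0 → P = 0) :
    Subsingleton (galoisCohomology
      (GaloisRep.restrictField (v.adicCompletion K) (W.torsionGaloisModule n)) 1) := by
  haveI : CharZero (v.adicCompletion K) := charZero_adicCompletion v
  exact subsingleton_galoisCohomology_one_torsion_restrictField_of_forall_nsmul_eq_zero W
    (v.adicCompletion K) n (not_ringChar_residueField_dvd_of_natCast_not_mem v hv) htors

omit [NumberField K] [W.IsElliptic] in
/-- Under `H¹(F, E[n]) = 0`, every global class restricts to zero at `F`. [folklore] -/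
private theorem res_torsionGaloisModule_eq_zero_of_subsingleton (F : Type u) [Field F] [Algebra K F]
    (n : ℕ) [Subsingleton (galoisCohomology (GaloisRep.restrictField F (W.torsionGaloisModule n)) 1)]
    (c : galH1Torsion W (n : ℤ)) :
    galoisCohomology.res (W.torsionGaloisModule (n : ℤ)) F 1 c = 0 :=
  Subsingleton.elim _ _

omit [NumberField K] [W.IsElliptic] in
/-- A class of `H¹(K, E[n])` restricting to zero in `H¹(Γ_F, E[n])` satisfies the Selmer local condition
at `F` (`selmerLocalKer`, Silverman *AEC* X.§4 diagram (**); via the tree's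
`comap_res_kummerLocalConditionAt`: `selmerLocalKer = res⁻¹ 𝓛_F ∋ res⁻¹ 0`). The same statement with the
same proof idea is the tree's `mem_selmerLocalKer_of_res_eq_zero` (file `Kato2004/LocPKernelRankOnePlumbing`,
not imported here). [cite: SilvermanAEC2009, X.§4] -/
theorem mem_selmerLocalKer_of_res_torsionGaloisModule_eq_zero (F : Type u) [Field F] [Algebra K F]
    {n : ℤ} (c : galH1Torsion W n)
    (hc : galoisCohomology.res (W.torsionGaloisModule n) F 1 c = 0) : c ∈ selmerLocalKer W F n := by
  have hc' : galoisCohomology.res (W.torsionGaloisModule n) F 1 c ∈ W.kummerLocalConditionAt n F := by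
    rw [hc]; exact zero_mem _
  exact (SetLike.ext_iff.mp (W.comap_res_kummerLocalConditionAt n F) c).mp (AddSubgroup.mem_comap.mpr hc')

omit [NumberField K] [W.IsElliptic] in
/-- A class of `H¹(K, E[n])` restricting to zero in `H¹(Γ_F, E[n])` satisfies the STRICT local condition
at `F`: it dies in `H¹(F, E(K̄_F)[n])` (`torsionLocalKer`; push the bounding cochain along
`torsionPointsMap`). The tree's `mem_torsionLocalKer_iff_res_eq_zero` (file
`CasselsTateSelmerKolyvaginValue`, not imported here) is the equivalence for elliptic `W`; this direction
needs nothing. [cite: McCallumLMS1991, §3 (3)] -/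
theorem mem_torsionLocalKer_of_res_torsionGaloisModule_eq_zero (F : Type u) [Field F] [Algebra K F]
    {n : ℤ} (c : galH1Torsion W n)
    (hc : galoisCohomology.res (W.torsionGaloisModule n) F 1 c = 0) : c ∈ W.torsionLocalKer F n := by
  obtain ⟨φ, rfl⟩ := oneCocycleClass_surjective (discreteTopRep (absoluteGaloisGroup K) (geomTorsion W n)) c
  rw [WeierstrassCurve.res_torsionGaloisModule_oneCocycleClass] at hc
  obtain ⟨P, hP⟩ := (oneCocycleClass_eq_zero_iff _ _).mp hc
  rw [WeierstrassCurve.torsionLocalKer, oneCocycleClass_mem_resKer_iff]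
  refine ⟨torsionPointsMap W F n P, fun g ↦ ?_⟩
  have h1 : φ.1 (resGal (K := K) F g) = resGal (K := K) F g • P - P := by
    rw [WeierstrassCurve.resGal_eq_absGaloisRestrict]; exact hP g
  rw [h1, map_sub, torsionPointsMap_smul]

/-- **The Selmer local condition at `v ∤ n` is EMPTY when `E(K_v)[n] = 0`**: every class of `H¹(K, E[n])`
lies in `selmerLocalKer W (v.adicCompletion K) n` (it even restricts to zero in `H¹(K_v, E[n]) = 0`).
This is «at `v ∣ 3` and `v ∣ p` nothing to check because `H¹(K_w, X[2^M]) = 0`» of the `p = 2` Kolyvagin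
argument for the Hu–Shu–Yin pair (cell memo two §57.3), stated for any `E/K`, `v ∤ n`.
[cite: MilneADT2006, Ch. I, Cor. 2.3 and Thm. 2.8] [cite: GrossLMS1991, Prop. 6.2 (1)] -/
theorem _root_.WeierstrassCurve.mem_selmerLocalKer_adicCompletion_of_forall_nsmul_eq_zero (n : ℕ)
    [NeZero n] (hv : ((n : ℕ) : 𝓞 K) ∉ v.asIdeal)
    (htors : ∀ P : (W.baseChange (v.adicCompletion K)).toAffine.Point, n • P = 0 → P = 0)
    (c : galH1Torsion W (n : ℤ)) : c ∈ selmerLocalKer W (v.adicCompletion K) (n : ℤ) := by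
  haveI := subsingleton_galoisCohomology_one_torsion_adicCompletion_of_forall_nsmul_eq_zero W v n hv htors
  exact mem_selmerLocalKer_of_res_torsionGaloisModule_eq_zero W (v.adicCompletion K) c
    (res_torsionGaloisModule_eq_zero_of_subsingleton W (v.adicCompletion K) n c)

/-- Top form of `mem_selmerLocalKer_adicCompletion_of_forall_nsmul_eq_zero`:
`selmerLocalKer W K_v n = ⊤` when `E(K_v)[n] = 0`, `(n) ⊄ v`. [cite: MilneADT2006, Ch. I, Cor. 2.3 and Thm. 2.8] -/
theorem _root_.WeierstrassCurve.selmerLocalKer_adicCompletion_eq_top_of_forall_nsmul_eq_zero (n : ℕ)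
    [NeZero n] (hv : ((n : ℕ) : 𝓞 K) ∉ v.asIdeal)
    (htors : ∀ P : (W.baseChange (v.adicCompletion K)).toAffine.Point, n • P = 0 → P = 0) :
    selmerLocalKer W (v.adicCompletion K) (n : ℤ) = ⊤ :=
  eq_top_iff.mpr fun c _ ↦ W.mem_selmerLocalKer_adicCompletion_of_forall_nsmul_eq_zero v n hv htors c

/-- **The STRICT local condition at `v ∤ n` is EMPTY when `E(K_v)[n] = 0`**: every class of
`H¹(K, E[n])` lies in `torsionLocalKer W (v.adicCompletion K) n` (restricts to zero in `H¹(K_v, E[n])`).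
[cite: MilneADT2006, Ch. I, Cor. 2.3 and Thm. 2.8] [cite: McCallumLMS1991, §3 (3)] -/
theorem _root_.WeierstrassCurve.mem_torsionLocalKer_adicCompletion_of_forall_nsmul_eq_zero (n : ℕ)
    [NeZero n] (hv : ((n : ℕ) : 𝓞 K) ∉ v.asIdeal)
    (htors : ∀ P : (W.baseChange (v.adicCompletion K)).toAffine.Point, n • P = 0 → P = 0)
    (c : galH1Torsion W (n : ℤ)) : c ∈ W.torsionLocalKer (v.adicCompletion K) (n : ℤ) := by
  haveI := subsingleton_galoisCohomology_one_torsion_adicCompletion_of_forall_nsmul_eq_zero W v n hv htors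
  exact mem_torsionLocalKer_of_res_torsionGaloisModule_eq_zero W (v.adicCompletion K) c
    (res_torsionGaloisModule_eq_zero_of_subsingleton W (v.adicCompletion K) n c)

/-- Top form: `torsionLocalKer W K_v n = ⊤` when `E(K_v)[n] = 0`, `(n) ⊄ v`.
[cite: MilneADT2006, Ch. I, Cor. 2.3 and Thm. 2.8] -/
theorem _root_.WeierstrassCurve.torsionLocalKer_adicCompletion_eq_top_of_forall_nsmul_eq_zero (n : ℕ)
    [NeZero n] (hv : ((n : ℕ) : 𝓞 K) ∉ v.asIdeal)
    (htors : ∀ P : (W.baseChange (v.adicCompletion K)).toAffine.Point, n • P = 0 → P = 0) :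
    W.torsionLocalKer (v.adicCompletion K) (n : ℤ) = ⊤ :=
  eq_top_iff.mpr fun c _ ↦ W.mem_torsionLocalKer_adicCompletion_of_forall_nsmul_eq_zero v n hv htors c

/-- **Prime-power form for the descent**: if `E(K_v)` has no `ℓ`-torsion and `(ℓ) ⊄ v`, then at every
level `ℓ^k` (`k ≥ 0`) every class of `H¹(K, E[ℓ^k])` satisfies the Selmer local condition AND the strict
local condition at `v` — the shape consumed by leaf (L1) of
`Summits/…/Theorems/SylvesterTwoHeegnerIndexCoupledDescentAtTwo` at the additive places `v ∣ 3p` of the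
Hu–Shu–Yin pair (`ℓ = 2`). [cite: MilneADT2006, Ch. I, Cor. 2.3 and Thm. 2.8] -/
theorem _root_.WeierstrassCurve.mem_selmerLocalKer_and_mem_torsionLocalKer_adicCompletion_pow
    {ℓ : ℕ} (hℓ : ((ℓ : ℕ) : 𝓞 K) ∉ v.asIdeal) [NeZero ℓ]
    (htors : ∀ P : (W.baseChange (v.adicCompletion K)).toAffine.Point, ℓ • P = 0 → P = 0) (k : ℕ)
    (c : galH1Torsion W ((ℓ ^ k : ℕ) : ℤ)) :
    c ∈ selmerLocalKer W (v.adicCompletion K) ((ℓ ^ k : ℕ) : ℤ) ∧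
      c ∈ W.torsionLocalKer (v.adicCompletion K) ((ℓ ^ k : ℕ) : ℤ) := by
  have hv : ((ℓ ^ k : ℕ) : 𝓞 K) ∉ v.asIdeal := by
    rw [Nat.cast_pow]
    exact fun h ↦ hℓ (v.isPrime.mem_of_pow_mem k h)
  haveI : NeZero (ℓ ^ k) := ⟨pow_ne_zero k (NeZero.ne ℓ)⟩
  have htors' := forall_pow_nsmul_eq_zero_imp_of_forall_nsmul_eq_zero htors k
  exact ⟨W.mem_selmerLocalKer_adicCompletion_of_forall_nsmul_eq_zero v (ℓ ^ k) hv htors' c,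
    W.mem_torsionLocalKer_adicCompletion_of_forall_nsmul_eq_zero v (ℓ ^ k) hv htors' c⟩

end Vanishing

end Literature.NumberTheory.EllipticCurves
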